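import Summits.Schanuel.Schanuel.Theorems.ZilberEacNearResonantLabels
import Mathlib.Algebra.MvPolynomial.Equiv
import Mathlib.Analysis.SpecialFunctions.Complex.Log
import Mathlib.Topology.Algebra.Polynomial
import Mathlib.Algebra.BigOperators.Field
import HarnessLib

/-!
# The diagonal critical regime: the limit pairs `(2πik, T*_k)` are Zariski-generic in `ℂ²`

Zilber's Exponential-Algebraic Closedness, case ladder (host summit Schanuel, cell `pub-schanuel`,
seat 2, gen 13).  For the critical family `x₂ = r₀x₀ + r₁x₁ + c` (`r₀ + r₁ = 1`, `r₁ ∉ ℚ`) the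
diagonal-ray solutions of `ZilberEacDiagonalCriticalExistence` with labels `(p, k, ℓ = 0)` have
limits `v* = x₁ - x₀ → 2πik` and `y₂/m → T*_k = Φ(u_k)`, `u_k = e^{2πir₁k}`,
`Φ(u) = 2πip e^c u / (1 - e^c u)` (a Möbius function of the ROTATING unimodular number `u_k`).
THEOREM N₂ (`ZilberEacDiagonalCriticalElimination`) needs: no nonzero `Q ∈ ℂ[V, T]` vanishes at
all the pairs `(2πik, Φ(u_k))`.

**`diagonalCritical_pairs_generic`.**  For irrational `r₁`, `p ≠ 0` and every `c`: every nonzero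
`Q ∈ ℂ[V, T]` has `Q(2πik, Φ(u_k)) ≠ 0` for some `k ∈ ℕ` with `e^c u_k ≠ 1`.
Proof: write `Q = Σ_{a ≤ A} q_a(T) V^a` with `q_A ≠ 0`.  The rational function `q_A ∘ Φ` has a
nonzero numerator `R(u) = Σ_j q_{A,j} (αu)^j (1 - βu)^{N-j}` (`R(1/β) = q_{A,N}(2πip)^N ≠ 0`), so
`q_A(Φ(u_{k₀})) ≠ 0` for some good `k₀` (the `u_k` are pairwise distinct).  By Dirichlet
(`exists_labels_tendsto`) there are `d_i → ∞` with `u_{k₀ + d_i} → u_{k₀}`; along `k_i = k₀ + d_i`,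
`Q(2πik_i, Φ(u_{k_i}))/(2πik_i)^A → q_A(Φ(u_{k₀})) ≠ 0`, contradicting `Q(2πik_i, Φ(u_{k_i})) = 0`.

HONEST FRAMING: a genericity lemma; `EC(3,2)` OPEN; NOT Schanuel's conjecture; EAC ⇏ SC.
-/

noncomputable section

open Complex MvPolynomial Filter Topology

set_option linter.dupNamespace false

namespace Summit.Schanuel.Schanuel.Theorems

section Generic

/-- Two-variable evaluation through `finSuccEquiv`: `Q(v, t) = Σ_a q_a(t) v^a` with
`q_a = (finSuccEquiv ℂ 1 Q).coeff a ∈ ℂ[T]` (as `MvPolynomial (Fin 1) ℂ`). [folklore] -/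
theorem eval_fin_two_eq_sum (Q : MvPolynomial (Fin 2) ℂ) (v t : ℂ) :
    eval ![v, t] Q = ∑ a ∈ Finset.range ((finSuccEquiv ℂ 1 Q).natDegree + 1),
      eval (fun _ => t) ((finSuccEquiv ℂ 1 Q).coeff a) * v ^ a := by
  have e : (![v, t] : Fin 2 → ℂ) = Fin.cons v (fun _ => t) := by
    funext i
    refine Fin.cases ?_ (fun j => ?_) i
    · rfl
    · fin_cases j; rfl
  rw [e, eval_eq_eval_mv_eval', Polynomial.eval_eq_sum_range' (n := (finSuccEquiv ℂ 1 Q).natDegree + 1)]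
  · refine Finset.sum_congr rfl fun a _ => ?_
    rw [Polynomial.coeff_map]
  · exact (Polynomial.natDegree_map_le).trans_lt (Nat.lt_succ_self _)

/-- One-variable evaluation of `MvPolynomial (Fin 1) ℂ` through `uniqueAlgEquiv`. [folklore] -/
theorem eval_uniqueAlgEquiv_fin_one (L : MvPolynomial (Fin 1) ℂ) (t : ℂ) :
    Polynomial.eval t (uniqueAlgEquiv ℂ (Fin 1) L) = eval (fun _ => t) L :=
  eval₂_const_uniqueAlgEquiv

/-- `t ↦ L(t)` is continuous for `L ∈ MvPolynomial (Fin 1) ℂ`. [folklore] -/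
theorem continuous_eval_fin_one (L : MvPolynomial (Fin 1) ℂ) :
    Continuous fun t : ℂ => eval (fun _ => t) L := by
  have e : (fun t : ℂ => eval (fun _ => t) L) =
      fun t => Polynomial.eval t (uniqueAlgEquiv ℂ (Fin 1) L) := by
    funext t; rw [eval_uniqueAlgEquiv_fin_one]
  rw [e]
  exact Polynomial.continuous _

/-- The rotating unimodular numbers `u_k = e^{2πir₁k}` are pairwise distinct for `r₁ ∉ ℚ`.
[folklore] -/
theorem exp_two_pi_I_mul_irrational_injective {r₁ : ℝ} (hr : Irrational r₁) :
    Function.Injective fun k : ℕ => exp (2 * Real.pi * I * (r₁ : ℂ) * (k : ℂ)) := by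
  intro k k' h
  simp only at h
  have h' : exp (2 * Real.pi * I * (r₁ : ℂ) * (k : ℂ) - 2 * Real.pi * I * (r₁ : ℂ) * (k' : ℂ)) = 1 := by
    rw [Complex.exp_sub, h, div_self (Complex.exp_ne_zero _)]
  obtain ⟨n, hn⟩ := Complex.exp_eq_one_iff.1 h'
  have hreal : r₁ * ((k : ℝ) - k') = n := by
    have := hn
    have h2 : (2 * Real.pi * I : ℂ) ≠ 0 := Complex.two_pi_I_ne_zero
    have e : ((r₁ * ((k : ℝ) - k') : ℝ) : ℂ) = (n : ℂ) := by
      push_cast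
      have := mul_right_cancel₀ h2 (show ((r₁ : ℂ) * ((k : ℂ) - k')) * (2 * Real.pi * I) =
        (n : ℂ) * (2 * Real.pi * I) by linear_combination hn)
      exact this
    exact_mod_cast e
  by_contra hne
  have hkk : ((k : ℝ) - k') ≠ 0 := by
    rw [sub_ne_zero]; exact_mod_cast hne
  apply hr
  refine ⟨(n : ℚ) / ((k : ℚ) - k'), ?_⟩
  push_cast
  rw [div_eq_iff hkk]
  linarith

/-- **The limit pairs of the diagonal critical regime are Zariski-generic in `ℂ²`.**  See the module
docstring: `r₁` irrational, `p ≠ 0`, `c ∈ ℂ`; `u_k = e^{2πir₁k}`, `Φ(u) = 2πip e^c u/(1 - e^c u)`.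
Every nonzero `Q ∈ ℂ[V, T]` has `Q(2πik, Φ(u_k)) ≠ 0` for some `k ∈ ℕ` with `e^c u_k ≠ 1`. (new) -/
theorem diagonalCritical_pairs_generic {r₁ : ℝ} (hr : Irrational r₁) (c : ℂ) {p : ℤ} (hp : p ≠ 0)
    (Q : MvPolynomial (Fin 2) ℂ) (hQ : Q ≠ 0) :
    ∃ k : ℕ, exp c * exp (2 * Real.pi * I * (r₁ : ℂ) * (k : ℂ)) ≠ 1 ∧
      eval ![2 * Real.pi * I * (k : ℂ),
        2 * Real.pi * I * (p : ℂ) * (exp c * exp (2 * Real.pi * I * (r₁ : ℂ) * (k : ℂ))) /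
          (1 - exp c * exp (2 * Real.pi * I * (r₁ : ℂ) * (k : ℂ)))] Q ≠ 0 := by
  classical
  by_contra hall
  push Not at hall
  -- notation
  set u : ℕ → ℂ := fun k => exp (2 * Real.pi * I * (r₁ : ℂ) * (k : ℂ)) with hu
  set β : ℂ := exp c with hβ
  set α : ℂ := 2 * Real.pi * I * (p : ℂ) * exp c with hα
  set Φ : ℂ → ℂ := fun w => α * w / (1 - β * w) with hΦ
  have hΦk : ∀ k : ℕ, 2 * Real.pi * I * (p : ℂ) * (exp c * exp (2 * Real.pi * I * (r₁ : ℂ) * (k : ℂ))) /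
      (1 - exp c * exp (2 * Real.pi * I * (r₁ : ℂ) * (k : ℂ))) = Φ (u k) := by
    intro k; simp only [hΦ, hα, hβ, hu]; ring
  have hβ0 : β ≠ 0 := Complex.exp_ne_zero _
  have hP0 : (2 * Real.pi * I * (p : ℂ)) ≠ 0 :=
    mul_ne_zero Complex.two_pi_I_ne_zero (by exact_mod_cast hp)
  -- the `V`-expansion of `Q` and its leading coefficient
  set Pq := finSuccEquiv ℂ 1 Q with hPq
  have hPq0 : Pq ≠ 0 := fun h => hQ ((finSuccEquiv ℂ 1).injective (by rw [← hPq, h, map_zero]))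
  set A := Pq.natDegree with hA
  set L : Polynomial ℂ := uniqueAlgEquiv ℂ (Fin 1) (Pq.coeff A) with hL
  have hlead : Pq.coeff A ≠ 0 := by
    rw [hA, Polynomial.coeff_natDegree]; exact Polynomial.leadingCoeff_ne_zero.2 hPq0
  have hL0 : L ≠ 0 := fun h => hlead ((uniqueAlgEquiv ℂ (Fin 1)).injective (by rw [← hL, h, map_zero]))
  set N := L.natDegree with hN
  -- the numerator `R(w) = Σ_j L_j (αw)^j (1 - βw)^{N-j}` of `L ∘ Φ`
  set R : Polynomial ℂ := ∑ j ∈ Finset.range (N + 1), Polynomial.C (L.coeff j) *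
    (Polynomial.C α * Polynomial.X) ^ j * (1 - Polynomial.C β * Polynomial.X) ^ (N - j) with hR
  have hRΦ : ∀ w : ℂ, 1 - β * w ≠ 0 → R.eval w = (1 - β * w) ^ N * L.eval (Φ w) := by
    intro w hw
    have hw' : 1 - w * β ≠ 0 := by rwa [mul_comm] at hw
    rw [hR, Polynomial.eval_finsetSum, Polynomial.eval_eq_sum_range (p := L), Finset.mul_sum]
    refine Finset.sum_congr rfl fun j hj => ?_
    have hjN : j ≤ N := Nat.lt_succ_iff.1 (Finset.mem_range.1 hj)
    simp only [Polynomial.eval_mul, Polynomial.eval_C, Polynomial.eval_pow, Polynomial.eval_X,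
      Polynomial.eval_sub, Polynomial.eval_one, hΦ]
    rw [div_pow, show (1 - β * w) ^ N = (1 - β * w) ^ (N - j) * (1 - β * w) ^ j by
      rw [← pow_add, Nat.sub_add_cancel hjN]]
    field_simp
  have hRne : R ≠ 0 := by
    intro hR0
    have hev : R.eval β⁻¹ = L.coeff N * (α * β⁻¹) ^ N := by
      rw [hR, Polynomial.eval_finsetSum, Finset.sum_eq_single N]
      · simp
      · intro j hj hjN
        have hlt : j < N := lt_of_le_of_ne (Nat.lt_succ_iff.1 (Finset.mem_range.1 hj)) hjN
        simp only [Polynomial.eval_mul, Polynomial.eval_C, Polynomial.eval_pow, Polynomial.eval_X,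
          Polynomial.eval_sub, Polynomial.eval_one, mul_inv_cancel₀ hβ0, sub_self,
          zero_pow (Nat.sub_ne_zero_of_lt hlt), mul_zero]
      · intro h; exact absurd (Finset.self_mem_range_succ N) h
    rw [hR0, Polynomial.eval_zero] at hev
    have hLN : L.coeff N ≠ 0 := by
      rw [hN, Polynomial.coeff_natDegree]; exact Polynomial.leadingCoeff_ne_zero.2 hL0
    have hαβ : α * β⁻¹ ≠ 0 := by
      rw [hα, hβ, mul_assoc, mul_inv_cancel₀ hβ0, mul_one]; exact hP0
    exact mul_ne_zero hLN (pow_ne_zero _ hαβ) hev.symm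
  -- a good label `k₀` with `R(u_{k₀}) ≠ 0`
  have huinj : Function.Injective u := exp_two_pi_I_mul_irrational_injective hr
  have hbad1 : {k : ℕ | R.eval (u k) = 0}.Finite := by
    have hfin : (R.roots.toFinset : Set ℂ).Finite := Finset.finite_toSet _
    refine (hfin.preimage huinj.injOn).subset fun k hk => ?_
    simp only [Set.mem_preimage, Finset.mem_coe, Multiset.mem_toFinset]
    exact (Polynomial.mem_roots hRne).2 hk
  have hbad2 : {k : ℕ | 1 - β * u k = 0}.Finite := by
    refine Set.Subsingleton.finite fun k hk k' hk' => huinj ?_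
    simp only [Set.mem_setOf_eq] at hk hk'
    have e1 : β * u k = 1 := by linear_combination -hk
    have e2 : β * u k' = 1 := by linear_combination -hk'
    exact mul_left_cancel₀ hβ0 (e1.trans e2.symm)
  obtain ⟨k₀, hk₀⟩ := (hbad1.union hbad2).infinite_compl.nonempty
  simp only [Set.mem_compl_iff, Set.mem_union, Set.mem_setOf_eq, not_or] at hk₀
  obtain ⟨hRk₀, hgood₀⟩ := hk₀
  have hLΦ : L.eval (Φ (u k₀)) ≠ 0 := by
    intro h
    apply hRk₀
    rw [hRΦ _ hgood₀, h, mul_zero]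
  -- approach `u_{k₀}` by `u_{k₀ + d_i}`, `d_i → ∞`
  obtain ⟨d, n₁, hd, hdn⟩ := exists_labels_tendsto hr 0
  have hud : Tendsto (fun i => u (k₀ + d i)) atTop (𝓝 (u k₀)) := by
    have hrot : ∀ i, u (k₀ + d i) = u k₀ * exp (2 * Real.pi * I * ((r₁ * d i + n₁ i : ℝ) : ℂ)) := by
      intro i
      simp only [hu]
      rw [← Complex.exp_add]
      have hper : exp (2 * Real.pi * I * ((n₁ i : ℤ) : ℂ)) = 1 := by
        have := Complex.exp_int_mul_two_pi_mul_I (n₁ i)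
        rw [← this]; congr 1; ring
      rw [show 2 * Real.pi * I * (r₁ : ℂ) * ((k₀ + d i : ℕ) : ℂ) =
        2 * Real.pi * I * (r₁ : ℂ) * (k₀ : ℂ) + 2 * Real.pi * I * ((r₁ * d i + n₁ i : ℝ) : ℂ) -
          2 * Real.pi * I * ((n₁ i : ℤ) : ℂ) by push_cast; ring, Complex.exp_sub, hper, div_one]
    have hlim : Tendsto (fun i => u k₀ * exp (2 * Real.pi * I * ((r₁ * d i + n₁ i : ℝ) : ℂ))) atTop
        (𝓝 (u k₀ * exp (2 * Real.pi * I * ((0 : ℝ) : ℂ)))) :=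
      tendsto_const_nhds.mul ((Complex.continuous_exp.tendsto _).comp
        ((continuous_const.mul continuous_ofReal).tendsto 0 |>.comp hdn))
    rw [ofReal_zero, mul_zero, Complex.exp_zero, mul_one] at hlim
    exact hlim.congr fun i => (hrot i).symm
  -- along `k_i = k₀ + d_i`: eventually good, `Φ(u_{k_i}) → Φ(u_{k₀})`
  have hden : Tendsto (fun i => 1 - β * u (k₀ + d i)) atTop (𝓝 (1 - β * u k₀)) :=
    tendsto_const_nhds.sub (tendsto_const_nhds.mul hud)
  have hgood : ∀ᶠ i in atTop, 1 - β * u (k₀ + d i) ≠ 0 := hden.eventually_ne hgood₀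
  have hΦlim : Tendsto (fun i => Φ (u (k₀ + d i))) atTop (𝓝 (Φ (u k₀))) := by
    simp only [hΦ]
    exact (tendsto_const_nhds.mul hud).div hden hgood₀
  -- the coefficients `q_a(Φ(u_{k_i}))` converge, `(2πik_i)^a/(2πik_i)^A → 0` for `a < A`
  have hK : Tendsto (fun i => ((k₀ + d i : ℕ) : ℝ)) atTop atTop :=
    tendsto_natCast_atTop_atTop.comp (tendsto_atTop_mono (fun i => Nat.le_add_left _ _) hd)
  have hcoef : ∀ a, Tendsto (fun i => eval (fun _ => Φ (u (k₀ + d i))) (Pq.coeff a)) atTop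
      (𝓝 (eval (fun _ => Φ (u k₀)) (Pq.coeff a))) :=
    fun a => ((continuous_eval_fin_one (Pq.coeff a)).tendsto _).comp hΦlim
  have hratio : ∀ a, a < A → Tendsto (fun i => (2 * Real.pi * I * ((k₀ + d i : ℕ) : ℂ)) ^ a /
      (2 * Real.pi * I * ((k₀ + d i : ℕ) : ℂ)) ^ A) atTop (𝓝 0) := by
    intro a ha
    have h1 : Tendsto (fun i => ((((k₀ + d i : ℕ) : ℝ))⁻¹ : ℝ)) atTop (𝓝 0) :=
      tendsto_inv_atTop_zero.comp hK
    have h2 : Tendsto (fun i => (2 * Real.pi * I)⁻¹ * (((((k₀ + d i : ℕ) : ℝ))⁻¹ : ℝ) : ℂ)) atTop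
        (𝓝 ((2 * Real.pi * I)⁻¹ * 0)) := by
      refine tendsto_const_nhds.mul ?_
      have := (continuous_ofReal.tendsto (0 : ℝ)).comp h1
      rw [ofReal_zero] at this
      exact this
    rw [mul_zero] at h2
    have h3 := h2.pow (A - a)
    rw [zero_pow (Nat.sub_ne_zero_of_lt ha)] at h3
    refine h3.congr' ?_
    filter_upwards [hK.eventually_gt_atTop 0] with i hi
    have hk0 : ((k₀ + d i : ℕ) : ℂ) ≠ 0 := by
      have : (0 : ℝ) < ((k₀ + d i : ℕ) : ℝ) := hi
      exact_mod_cast this.ne'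
    have hX : (2 * Real.pi * I * ((k₀ + d i : ℕ) : ℂ)) ≠ 0 := mul_ne_zero Complex.two_pi_I_ne_zero hk0
    have e : (2 * Real.pi * I)⁻¹ * (((((k₀ + d i : ℕ) : ℝ))⁻¹ : ℝ) : ℂ) =
        (2 * Real.pi * I * ((k₀ + d i : ℕ) : ℂ))⁻¹ := by
      rw [Complex.ofReal_inv, Complex.ofReal_natCast, ← mul_inv]
    rw [e, inv_pow, eq_div_iff (pow_ne_zero _ hX), ← pow_sub_mul_pow _ ha.le,
      inv_mul_cancel_left₀ (pow_ne_zero _ hX)]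
  -- the normalised relation tends to `L(Φ(u_{k₀})) ≠ 0` but is eventually `0`
  have hterm : ∀ a ∈ Finset.range (A + 1), Tendsto (fun i =>
      eval (fun _ => Φ (u (k₀ + d i))) (Pq.coeff a) *
        ((2 * Real.pi * I * ((k₀ + d i : ℕ) : ℂ)) ^ a / (2 * Real.pi * I * ((k₀ + d i : ℕ) : ℂ)) ^ A))
      atTop (𝓝 (if a = A then eval (fun _ => Φ (u k₀)) (Pq.coeff A) else 0)) := by
    intro a ha
    have haA : a ≤ A := Nat.lt_succ_iff.1 (Finset.mem_range.1 ha)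
    rcases haA.lt_or_eq with hlt | heq
    · rw [if_neg hlt.ne]
      simpa using (hcoef a).mul (hratio a hlt)
    · rw [if_pos heq, heq]
      refine (hcoef A).congr' ?_
      filter_upwards [hK.eventually_gt_atTop 0] with i hi
      have hk0 : ((k₀ + d i : ℕ) : ℂ) ≠ 0 := by
        have : (0 : ℝ) < ((k₀ + d i : ℕ) : ℝ) := hi
        exact_mod_cast this.ne'
      rw [div_self (pow_ne_zero _ (mul_ne_zero Complex.two_pi_I_ne_zero hk0)), mul_one]
  have hsum := tendsto_finsetSum (Finset.range (A + 1)) hterm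
  rw [Finset.sum_ite_eq' (Finset.range (A + 1)) A, if_pos (Finset.self_mem_range_succ A)] at hsum
  have hzero : ∀ᶠ i in atTop, ∑ a ∈ Finset.range (A + 1),
      eval (fun _ => Φ (u (k₀ + d i))) (Pq.coeff a) *
        ((2 * Real.pi * I * ((k₀ + d i : ℕ) : ℂ)) ^ a / (2 * Real.pi * I * ((k₀ + d i : ℕ) : ℂ)) ^ A) = 0 := by
    filter_upwards [hgood] with i hi
    have hrel := hall (k₀ + d i) (by
      intro h; apply hi; simp only [hβ, hu]; linear_combination -h)
    rw [hΦk, eval_fin_two_eq_sum] at hrel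
    have : ∑ a ∈ Finset.range (A + 1), eval (fun _ => Φ (u (k₀ + d i))) (Pq.coeff a) *
        ((2 * Real.pi * I * ((k₀ + d i : ℕ) : ℂ)) ^ a / (2 * Real.pi * I * ((k₀ + d i : ℕ) : ℂ)) ^ A) =
        (∑ a ∈ Finset.range (A + 1), eval (fun _ => Φ (u (k₀ + d i))) (Pq.coeff a) *
          (2 * Real.pi * I * ((k₀ + d i : ℕ) : ℂ)) ^ a) / (2 * Real.pi * I * ((k₀ + d i : ℕ) : ℂ)) ^ A := by
      rw [Finset.sum_div]
      refine Finset.sum_congr rfl fun a _ => ?_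
      ring
    rw [this, hrel, zero_div]
  have hlim0 : Tendsto (fun i => ∑ a ∈ Finset.range (A + 1),
      eval (fun _ => Φ (u (k₀ + d i))) (Pq.coeff a) *
        ((2 * Real.pi * I * ((k₀ + d i : ℕ) : ℂ)) ^ a / (2 * Real.pi * I * ((k₀ + d i : ℕ) : ℂ)) ^ A))
      atTop (𝓝 0) := tendsto_const_nhds.congr' (hzero.mono fun i hi => hi.symm)
  have huniq := tendsto_nhds_unique hsum hlim0
  apply hLΦ
  rw [eval_uniqueAlgEquiv_fin_one]
  exact huniq

end Generic

end Summit.Schanuel.Schanuel.Theorems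

end
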